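import Mathlib
import Summits.AtomisticToContinuum.Crystallization.Theses.HolmgrenBoyleLind
import Summits.AtomisticToContinuum.Crystallization.Theorems.HolmgrenBoyleLindFLCEquilibriumPeriodicIffUC

/-!
# Strategist sketch for crux `HalfSpaceUniqueContinuation` (stmt-AtomisticToContinuum-6075)

Two FIRST LEMMAS of the crux ideas filed by the crux-strategist (cstrat-…-6075-s2):

* `ModelSetIntervalNotBalanced` (idea `internal-space-window-jumps`, lens: negation → typed
  obstruction): a cut-and-project set with one-dimensional internal space and an interval window
  (module `M`, injective additive "star map" `φ`, `Λ = {x ∈ M | φ x ∈ [α, β]}`, `φ(M)` dense in the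
  window) that is Delone and FLC is NEVER in exact Lennard-Jones force balance.
* `RingNeutralOfNullLine` (idea `ring-neutrality`, lens: transfer of the FiniteRigidity moment
  cascade from the point at infinity to the complex poles `t ± iρ` of a null normal line): if the
  signed field of two disjoint separated source sets lying on or above the plane `⟪·,u⟫ = a`
  vanishes along a normal half-line below, then every ring {height `t`, horizontal distance `ρ`
  from the line} carries as many `+` sources as `−` sources.
-/

namespace Summit.AtomisticToContinuum.Crystallization.Cruxes.HalfSpaceUniqueContinuation.Strategist

open scoped BigOperators InnerProductSpace
open Literature.MathematicalPhysics.StatisticalMechanics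

local notation "𝔼" => EuclideanSpace ℝ (Fin 3)

/-- First lemma of idea `internal-space-window-jumps`: model sets with 1-D internal space and
interval window are never exact Lennard-Jones equilibria (window-boundary jump identity
`K(v) = K(v - ℓ)` resp. `K(v) = 0` on a relatively dense set of module vectors `v`). -/
def ModelSetIntervalNotBalanced : Prop :=
  ∀ (M : AddSubgroup 𝔼) (φ : 𝔼 →+ ℝ) (α β δ r : ℝ), α < β → 0 < δ → 0 < r →
    (∀ x ∈ M, φ x = 0 → x = 0) →
    (∀ a b : ℝ, α ≤ a → a < b → b ≤ β → ∃ x ∈ M, a < φ x ∧ φ x < b) →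
    ∀ Λ : Set 𝔼, (∀ x : 𝔼, x ∈ Λ ↔ (x ∈ M ∧ α ≤ φ x ∧ φ x ≤ β)) →
      (∀ x ∈ Λ, ∀ y ∈ Λ, x ≠ y → δ ≤ dist x y) →
      (∀ c : 𝔼, ∃ y ∈ Λ, dist y c ≤ r) →
      (∀ R : ℝ, Set.Finite {S : Set 𝔼 | ∃ x ∈ Λ, S = {v : 𝔼 | x + v ∈ Λ ∧ ‖v‖ ≤ R}}) →
      ∃ x ∈ Λ, ¬ HasSum (fun y : {y : 𝔼 // y ∈ Λ ∧ y ≠ x} =>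
        (deriv lennardJones (dist x (y : 𝔼)) / dist x (y : 𝔼)) • (x - (y : 𝔼))) 0

/-- First lemma of idea `ring-neutrality`: a null normal half-line forces charge neutrality of
every (height, horizontal radius) ring of the signed source set. -/
def RingNeutralOfNullLine : Prop :=
  ∀ (Xp Xm : Set 𝔼) (δ a b : ℝ) (c u : 𝔼), 0 < δ → ‖u‖ = 1 → b < a → Disjoint Xp Xm →
    (∀ x ∈ Xp ∪ Xm, ∀ y ∈ Xp ∪ Xm, x ≠ y → δ ≤ dist x y) →
    (∀ y ∈ Xp ∪ Xm, a ≤ ⟪y, u⟫_ℝ) →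
    (∀ s : ℝ, s < b →
      (∑' y : Xp, (deriv lennardJones (dist (c + s • u) (y : 𝔼)) / dist (c + s • u) (y : 𝔼)) •
          (c + s • u - (y : 𝔼))) -
        (∑' y : Xm, (deriv lennardJones (dist (c + s • u) (y : 𝔼)) / dist (c + s • u) (y : 𝔼)) •
          (c + s • u - (y : 𝔼))) = 0) →
    ∀ t ρ : ℝ, 0 < ρ →
      {y ∈ Xp | ⟪y, u⟫_ℝ = t ∧ ‖(y - c) - ⟪y - c, u⟫_ℝ • u‖ = ρ}.ncard =
        {y ∈ Xm | ⟪y, u⟫_ℝ = t ∧ ‖(y - c) - ⟪y - c, u⟫_ℝ • u‖ = ρ}.ncard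

/-! ## Census signatures (STRATEGY-CENSUS.md): the strengthening S⁺ and the address-rank split -/

/-- S⁺ of § Strengthen: general pair unique continuation WITHOUT hull / finite local complexity —
two `δ`-separated, `r`-dense sets in exact Lennard-Jones balance agreeing on an open half-space
coincide. Strictly stronger than the crux (which only quantifies over pairs in one FLC patch-hull). -/
def GeneralPairUC : Prop :=
  ∀ (ω ω' : Set 𝔼) (δ r : ℝ), 0 < δ → 0 < r →
    (∀ x ∈ ω, ∀ y ∈ ω, x ≠ y → δ ≤ dist x y) → (∀ x ∈ ω', ∀ y ∈ ω', x ≠ y → δ ≤ dist x y) →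
    (∀ c : 𝔼, ∃ y ∈ ω, dist y c ≤ r) → (∀ c : 𝔼, ∃ y ∈ ω', dist y c ≤ r) →
    (∀ x ∈ ω, HasSum (fun y : {y : 𝔼 // y ∈ ω ∧ y ≠ x} =>
      (deriv lennardJones (dist x (y : 𝔼)) / dist x (y : 𝔼)) • (x - (y : 𝔼))) 0) →
    (∀ x ∈ ω', HasSum (fun y : {y : 𝔼 // y ∈ ω' ∧ y ≠ x} =>
      (deriv lennardJones (dist x (y : 𝔼)) / dist x (y : 𝔼)) • (x - (y : 𝔼))) 0) →
    ∀ (u : 𝔼) (a : ℝ), u ≠ 0 → (∀ z : 𝔼, ⟪z, u⟫_ℝ < a → (z ∈ ω ↔ z ∈ ω')) → ω = ω'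

/-- Piece 1 of the § Decomposition split (address rank 3 = LATTICE GAS): an FLC Delone exact
Lennard-Jones equilibrium all of whose difference vectors lie in one lattice is fully periodic. -/
def LatticeGasPeriodic : Prop :=
  ∀ (Λ : Set 𝔼) (δ r : ℝ), 0 < δ → 0 < r →
    (∀ x ∈ Λ, ∀ y ∈ Λ, x ≠ y → δ ≤ dist x y) → (∀ c : 𝔼, ∃ y ∈ Λ, dist y c ≤ r) →
    (∀ R : ℝ, Set.Finite {S : Set 𝔼 | ∃ x ∈ Λ, S = {v : 𝔼 | x + v ∈ Λ ∧ ‖v‖ ≤ R}}) →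
    (∀ x ∈ Λ, HasSum (fun y : {y : 𝔼 // y ∈ Λ ∧ y ≠ x} =>
      (deriv lennardJones (dist x (y : 𝔼)) / dist x (y : 𝔼)) • (x - (y : 𝔼))) 0) →
    (∃ b : Module.Basis (Fin 3) ℝ 𝔼, ∀ x ∈ Λ, ∀ y ∈ Λ, x - y ∈ Submodule.span ℤ (Set.range b)) →
    ∃ P : PeriodicConfiguration 3, P.points = Λ

/-- Piece 2 of the § Decomposition split (address rank ≥ 4 = MODULE CASE): the same conclusion
when NO lattice contains all difference vectors (by Lagarias' finite-type theorem `⟨Λ − Λ⟩_ℤ` is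
then free of rank ≥ 4 and dense in some direction). -/
def ModuleCasePeriodic : Prop :=
  ∀ (Λ : Set 𝔼) (δ r : ℝ), 0 < δ → 0 < r →
    (∀ x ∈ Λ, ∀ y ∈ Λ, x ≠ y → δ ≤ dist x y) → (∀ c : 𝔼, ∃ y ∈ Λ, dist y c ≤ r) →
    (∀ R : ℝ, Set.Finite {S : Set 𝔼 | ∃ x ∈ Λ, S = {v : 𝔼 | x + v ∈ Λ ∧ ‖v‖ ≤ R}}) →
    (∀ x ∈ Λ, HasSum (fun y : {y : 𝔼 // y ∈ Λ ∧ y ≠ x} =>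
      (deriv lennardJones (dist x (y : 𝔼)) / dist x (y : 𝔼)) • (x - (y : 𝔼))) 0) →
    (¬ ∃ b : Module.Basis (Fin 3) ℝ 𝔼, ∀ x ∈ Λ, ∀ y ∈ Λ, x - y ∈ Submodule.span ℤ (Set.range b)) →
    ∃ P : PeriodicConfiguration 3, P.points = Λ

/-- The split is exhaustive by excluded middle and reaches the crux through the landed
equivalence `flcEquilibriumPeriodic_iff_uc` (sorry-free; recorded to certify the census claim
that the seam is trivial and both pieces are genuine restrictions). -/
theorem halfSpaceUniqueContinuation_of_addressSplit
    (h₁ : LatticeGasPeriodic) (h₂ : ModuleCasePeriodic) :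
    Summit.AtomisticToContinuum.Crystallization.Theses.HolmgrenBoyleLind.HalfSpaceUniqueContinuation := by
  classical
  refine Summit.AtomisticToContinuum.Crystallization.Theorems.flcEquilibriumPeriodic_iff_uc.1 ?_
  intro Λ δ r hδ hr hsep hden hFLC hbal
  by_cases hL : ∃ b : Module.Basis (Fin 3) ℝ 𝔼, ∀ x ∈ Λ, ∀ y ∈ Λ, x - y ∈ Submodule.span ℤ (Set.range b)
  · exact h₁ Λ δ r hδ hr hsep hden hFLC hbal hL
  · exact h₂ Λ δ r hδ hr hsep hden hFLC hbal hL

end Summit.AtomisticToContinuum.Crystallization.Cruxes.HalfSpaceUniqueContinuation.Strategist
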